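import Summits.ValiantsHypothesis.ValiantsHypothesis.Theorems.NewtonUnitEquationsTwoProductsRankOneAPLawWeights
import HarnessLib

/-!
# Route NewtonUnitEquations — crux `TwoProducts` (stmt-ValiantsHypothesis-5906), line `relation_ladder`, rung R6c (three-term
# rank one, arithmetic-progression shape `2β = α + γ`): the VERONESE LIFT — part 5/5 — the count, the arithmetic, and the law `rankOneThreeAPLaw_proof` (Part V5 end)

val-lit-p3 g15 (prover seat, helper mode `--supports stmt-ValiantsHypothesis-5906 --as helper`), 2026-08-28.  Rung R6c of val-idea-8's line
`relation_ladder` (card `Lines/relation_ladder.md` v14 l.28–35; engine memo `Lines/relation_ladder_R6_engine.md` rev 3 §7′: «`2β = α + γ` (3-AP,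
`ρ⁺ = {β,β}`): Veronese `X_α ↦ Z², X_β ↦ ZW, X_γ ↦ W²` after DOUBLING all planar exponents»).  THE THREE-TERM ARITHMETIC-PROGRESSION RANK-ONE
LAW: if ALL additive coincidences of the letter family `A_j = supp u_j ∪ supp v_j` come from ONE relation `α + γ = β + β` among DISTINCT
letters (`RankOneCoincidences A (2·e_β) (e_α + e_γ)`), then GLOBALLY `#visible ≤ 2^{c m} (#T + 2)^c` — the statement shape of R3♯
`permTypeLaw_proof` / R6 `rankOneFourLaw_proof` / R6b `R6b.rankOneThreeLaw_proof`.  MECHANISM: the VERONESE LIFT realises the toric ring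
`ℂ[Y]/(Y_β² − Y_αY_γ)` inside a FREE ring (variables `Z = Y_a`, `W = Y_c`, `Y_b` dead); the planar push-forward `Z ↦ α, W ↦ γ, Y_e ↦ 2e`
DOUBLES every planar exponent INSIDE the push-forward (`phi E' ∘ φ_ver = doubling ∘ phi enum`), so the instance `(u, v)` is never changed and
`ℕ²`-integrality is automatic; rank-one coincidences = injectivity on the lifted support (one level up from R3♯'s `injOn_of_permType`); Lemma A
upstairs = the tree's `toric_minLog`; the fibre of the lift over a balanced exponent is `{#β = k : k ≡ x_Z (mod 2), k ≤ min(x_Z, x_W)}` with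
CONSTANT letter count, and the multinomial regroups as `multinomial(x̂)·C(h,(x_W+k)/2)·C((x_W+k)/2,k)` in the HALF-DEGREE `h = (x_Z+x_W)/2` —
so with the reduced exponent `x̂ = (h @ Z, 0 @ Y_b, 0 @ W, rest)` every slice `b = x_W ≤ 2m` is a plain BINOMIAL-EXPONENTIAL sum of width
`≤ 2m(2m+1)²` (no parity bases, no square roots), counted by val-lit-p3 g14's tool `BinExpSum.binExpPencilCount` (p620797) through the landed
`binExpPencilCount_fintype`; the slice identity `θ(x) = 2·Σ_i (−wt ξ ŝ_i) x̂_i + (Γ − A)·x_W` makes the slice functional affine along the pencil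
of valid weights; degenerate case (a relation letter outside the alphabet) via R3♯.  All statements are by LITERAL body (no parameter-free
`def … : Prop`); generic toolkit (`phiT/piT`, `binChar/bsum/bwidth`, `toric_minLog`, `RankOneCoincidences`, `idxOf`, `rW`, `lwt_*`, `SIdx/tab/sgn`)
and the three-index API (`R6b.ThreeIdx`, `R6b.rest`, `R6b.prod_three_split`, …) are IMPORTED from the landed R6 / R6b ports, not re-declared.
Honest scope: helper layer; nothing here closes the residual of the line, the crux `TwoProducts` (5906) or `VP ≠ VNP`; no summit statement is
proved. [folklore]
-/

noncomputable section

-- Sub = Summit single-conjunct layout: the duplicated namespace component is mandated by the tree.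
set_option linter.dupNamespace false
set_option linter.unusedSimpArgs false

namespace Summit.ValiantsHypothesis.ValiantsHypothesis.Theorems.NewtonUnitEquations.TwoProducts.PermutationType
namespace R6c
open scoped BigOperators
open MvPolynomial

variable {σ : Type*} [Fintype σ] [DecidableEq σ]

variable (J : R6b.ThreeIdx σ)

/-! ## Part V5 (end): the count; the arithmetic; the law -/

section VeroneseCount
open Summit.ValiantsHypothesis.ValiantsHypothesis.Theorems.NewtonUnitEquations.TwoProducts.FormalLogLinearisation
open Summit.ValiantsHypothesis.ValiantsHypothesis.Theorems.NewtonUnitEquations.TwoProducts.PlanarCell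

variable {m : ℕ} {u v : Fin m → MvPolynomial (Fin 2) ℂ} (D : APData u v)

/-- The Veronese slice bound, uniform in `b ≤ 2m`. [folklore] -/
def vsliceBd (A m s : ℕ) : ℕ :=
  (s + 2) ^ A * (2 * m * (2 * m + 1) ^ 2 + 2) ^ (A * (Nat.log 2 (2 * m * (2 * m + 1) ^ 2 + 2) + 1))

omit [Fintype σ] [DecidableEq σ] in
/-- **The count for a non-degenerate three-term rank-one relation** (all three letters in the alphabet). [folklore] -/
theorem APData.count {A : ℕ}
    (hA : ∀ (s : ℕ) (κ : Type) [Fintype κ] (C : κ → ℂ) (a : κ → Fin s → ℂ) (d : κ → Fin s → ℕ)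
      (u v : Fin s → ℝ) (S : Finset (Fin s → ℕ)),
      (∀ μ ∈ S, bsum C a d μ ≠ 0 ∧ ∃ t : ℝ, ∀ ν : Fin s → ℕ, ν ≠ μ → bsum C a d ν ≠ 0 →
        ∑ i, (u i + t * v i) * (μ i : ℝ) < ∑ i, (u i + t * v i) * (ν i : ℝ)) →
      S.card ≤ (s + 2) ^ A * (bwidth d + 2) ^ (A * (Nat.log 2 (bwidth d + 2) + 1)))
    (hu : ∀ j, coeff 0 (u j) = 0) (hv : ∀ j, coeff 0 (v j) = 0)
    (hR : RankOneCoincidences (fun j => (u j).support ∪ (v j).support)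
      (Finsupp.single D.β 2) (Finsupp.single D.α 1 + Finsupp.single D.γ 1))
    (S : Finset Expo) (hS : ∀ l ∈ S, ∃ ξ : Fin 2 → ℝ, ValidWeight u v ξ ∧ IsStrictTop ξ ↑(tailDiff u v).support l) :
    S.card ≤ (2 * m + 1) * vsliceBd A m (sE u v) := by
  classical
  rcases S.eq_empty_or_nonempty with hSe | hSne
  · simp [hSe]
  obtain ⟨l₀, hl₀⟩ := hSne
  obtain ⟨ξ₀, hval₀, htop₀⟩ := hS l₀ hl₀
  have hTne : (tailSupport u v).Nonempty := tailSupport_nonempty_of_mem u v l₀ htop₀.1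
  have hsE : 0 < sE u v := Finset.card_pos.mpr hTne
  set e₀ : Expo := enum u v ⟨0, hsE⟩ with he₀def
  have he₀ : e₀ ≠ 0 := enum_ne_zero u v hu hv _
  obtain ⟨β, τ, hpencil⟩ := pencil_param e₀ he₀
  have hinj := D.injOn_of_rankOne hu hv hR
  -- choices along `S`
  have hξ : ∀ x : ↥S, ∃ ξ : Fin 2 → ℝ, ValidWeight u v ξ ∧ IsStrictTop ξ ↑(tailDiff u v).support x.1 :=
    fun x => hS x.1 x.2
  choose ξf hξval hξtop using hξ
  have hpt : ∀ x : ↥S, ∃ x₀ : Fin (sE u v) →₀ ℕ, piE D.E' x₀ = 2 • x.1 ∧ VBal D.idx x₀ ∧ x₀ D.idx.c ≤ 2 * m ∧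
      VFsl D.idx (cU u v) (cV u v) (x₀ D.idx.c) (vhat D.idx x₀) ≠ 0 ∧
      ∀ ν : Fin (sE u v) → ℕ, ν ≠ ⇑(vhat D.idx x₀) → VFsl D.idx (cU u v) (cV u v) (x₀ D.idx.c) ν ≠ 0 →
        ∑ i, -wt (ξf x) (D.swLetter i) * ((vhat D.idx x₀ i : ℕ) : ℝ) < ∑ i, -wt (ξf x) (D.swLetter i) * (ν i : ℝ) :=
    fun x => D.sliceMin_of_visible hu hv hinj (ξf x) (hξval x) x.1 (hξtop x)
  choose xf hxπ hxbal hxc hxF hxmin using hpt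
  -- normalisation radii and the pencil parameter
  have hrpos : ∀ x : ↥S, 0 < -wt (ξf x) e₀ := fun x => by
    linarith [wt_enum_neg u v (ξf x) (hξval x) ⟨0, hsE⟩]
  have hnorm : ∀ x : ↥S, wt (fun k => ξf x k / (-wt (ξf x) e₀)) e₀ = -1 := fun x => by
    rw [wt_weight_div]
    have hne : wt (ξf x) e₀ ≠ 0 := by linarith [hrpos x]
    rw [div_neg, div_self hne]
  have hc : ∀ x : ↥S, ∃ c : ℝ, ∀ e : Expo, wt (fun k => ξf x k / (-wt (ξf x) e₀)) e = wt β e + c * wt τ e :=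
    fun x => hpencil _ (hnorm x)
  choose cf hcf using hc
  set U : Fin (sE u v) → ℝ := fun i => -wt β (D.swLetter i) with hU
  set V : Fin (sE u v) → ℝ := fun i => -wt τ (D.swLetter i) with hV
  have hUV : ∀ (x : ↥S) (i : Fin (sE u v)),
      U i + cf x * V i = -wt (ξf x) (D.swLetter i) / (-wt (ξf x) e₀) := fun x i => by
    have h := hcf x (D.swLetter i)
    rw [wt_weight_div] at h
    rw [hU, hV]
    simp only
    rw [neg_div, h]
    ring
  have hsumUV : ∀ (x : ↥S) (ν : Fin (sE u v) → ℕ), ∑ i, (U i + cf x * V i) * (ν i : ℝ) =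
      (∑ i, -wt (ξf x) (D.swLetter i) * (ν i : ℝ)) / (-wt (ξf x) e₀) := fun x ν => by
    rw [Finset.sum_div]
    refine Finset.sum_congr rfl fun i _ => ?_
    rw [hUV x i]
    ring
  -- the key map `l ↦ (b, x̂₀)` is injective
  set key : ↥S → ℕ × (Fin (sE u v) → ℕ) := fun x => (xf x D.idx.c, ⇑(vhat D.idx (xf x))) with hkey
  have hinjK : Function.Injective key := by
    intro x y h
    rw [hkey] at h
    simp only [Prod.mk.injEq] at h
    have hx : xf x = xf y := by
      rw [← vxOf_vhat D.idx (xf x) (hxbal x), ← vxOf_vhat D.idx (xf y) (hxbal y), h.1]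
      exact congrArg _ h.2
    apply Subtype.ext
    apply two_nsmul_inj_expo
    rw [← hxπ x, ← hxπ y, hx]
  set Img : Finset (ℕ × (Fin (sE u v) → ℕ)) := (Finset.univ : Finset ↥S).image key with hImg
  have hcard : Img.card = S.card := by
    rw [hImg, Finset.card_image_of_injective _ hinjK, Finset.card_univ, Fintype.card_coe]
  have hfst : ∀ p ∈ Img, p.1 ∈ Finset.range (2 * m + 1) := by
    intro p hp
    obtain ⟨x, -, rfl⟩ := Finset.mem_image.mp hp
    exact Finset.mem_range.mpr (Nat.lt_succ_of_le (hxc x))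
  have hfib : ∀ b ∈ Finset.range (2 * m + 1), (Img.filter fun p => p.1 = b).card ≤ vsliceBd A m (sE u v) := by
    intro b hb
    have hbm : b ≤ 2 * m := Nat.lt_succ_iff.mp (Finset.mem_range.mp hb)
    set Sb : Finset (Fin (sE u v) → ℕ) := (Img.filter fun p => p.1 = b).image Prod.snd with hSb
    have hcardb : (Img.filter fun p => p.1 = b).card = Sb.card := by
      rw [hSb, Finset.card_image_of_injOn]
      intro p hp q hq hpq
      have hp' := (Finset.mem_filter.mp (Finset.mem_coe.mp hp)).2
      have hq' := (Finset.mem_filter.mp (Finset.mem_coe.mp hq)).2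
      exact Prod.ext (hp'.trans hq'.symm) hpq
    rw [hcardb]
    have hhyp : ∀ μ ∈ Sb,
        bsum (vtermC D.idx (cU u v) (cV u v) b) (vtermA D.idx (cU u v) (cV u v) b) (vtermD D.idx b) μ ≠ 0 ∧
        ∃ t : ℝ, ∀ ν : Fin (sE u v) → ℕ, ν ≠ μ →
          bsum (vtermC D.idx (cU u v) (cV u v) b) (vtermA D.idx (cU u v) (cV u v) b) (vtermD D.idx b) ν ≠ 0 →
            ∑ i, (U i + t * V i) * (μ i : ℝ) < ∑ i, (U i + t * V i) * (ν i : ℝ) := by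
      intro μ hμ
      obtain ⟨p, hp, rfl⟩ := Finset.mem_image.mp hμ
      obtain ⟨hpI, hpb⟩ := Finset.mem_filter.mp hp
      obtain ⟨x, -, rfl⟩ := Finset.mem_image.mp hpI
      rw [hkey] at hpb ⊢
      simp only at hpb ⊢
      refine ⟨?_, cf x, fun ν hν hFν => ?_⟩
      · have := hxF x
        unfold VFsl at this
        rw [hpb] at this
        exact this
      · have hFν' : VFsl D.idx (cU u v) (cV u v) (xf x D.idx.c) ν ≠ 0 := by
          unfold VFsl; rw [hpb]; exact hFν
        have hlt := hxmin x ν hν hFν'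
        rw [hsumUV x, hsumUV x ν]
        exact div_lt_div_of_pos_right hlt (hrpos x)
    have hwidth : bwidth (vtermD D.idx b : SIdx m b → Fin (sE u v) → ℕ) ≤ 2 * m * (2 * m + 1) ^ 2 :=
      (bwidth_vtermD_le D.idx b).trans (Nat.mul_le_mul_left _ (Nat.pow_le_pow_left (by omega) 2))
    calc Sb.card ≤ (sE u v + 2) ^ A * (bwidth (vtermD D.idx b : SIdx m b → Fin (sE u v) → ℕ) + 2) ^
          (A * (Nat.log 2 (bwidth (vtermD D.idx b : SIdx m b → Fin (sE u v) → ℕ) + 2) + 1)) :=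
          hA (sE u v) (SIdx m b) _ _ _ U V Sb hhyp
      _ ≤ vsliceBd A m (sE u v) := toolBound_mono _ _ hwidth
  rw [← hcard, Finset.card_eq_sum_card_fiberwise hfst]
  calc ∑ b ∈ Finset.range (2 * m + 1), (Img.filter fun p => p.1 = b).card
      ≤ ∑ b ∈ Finset.range (2 * m + 1), vsliceBd A m (sE u v) := Finset.sum_le_sum hfib
    _ = (2 * m + 1) * vsliceBd A m (sE u v) := by rw [Finset.sum_const, Finset.card_range, smul_eq_mul]

omit [Fintype σ] [DecidableEq σ] in
/-- **Arithmetic**: `(2m+1) · vsliceBd ≤ 2^{c m} (s+2)^c` and `2^{13m}(s+2)^2 ≤ 2^{c m}(s+2)^c` with `c = 169A + 13`.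
[folklore] -/
theorem arith_R6c (A : ℕ) : ∃ c : ℕ,
    (∀ m s : ℕ, 1 ≤ m → (2 * m + 1) * vsliceBd A m s ≤ 2 ^ (c * m) * (s + 2) ^ c) ∧
    (∀ m s : ℕ, 2 ^ (13 * m) * (s + 2) ^ 2 ≤ 2 ^ (c * m) * (s + 2) ^ c) := by
  refine ⟨169 * A + 13, fun m s hm => ?_, fun m s => ?_⟩
  · set p : ℕ := Nat.log 2 (m + 1) with hp
    have hp1 : m + 1 < 2 ^ (p + 1) := Nat.lt_pow_succ_log_self (by norm_num) (m + 1)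
    have hp2 : 2 ^ p ≤ m + 1 := Nat.pow_log_le_self 2 (by omega)
    have hpp : p < 2 ^ p := Nat.lt_two_pow_self
    have hp3 : p * p ≤ 2 ^ (p + 1) := sq_le_two_pow_succ p
    have h2p : 2 ^ (p + 1) = 2 * 2 ^ p := pow_succ' 2 p
    set N : ℕ := 2 * m * (2 * m + 1) ^ 2 with hN
    have hN1 : N + 2 ≤ 8 * (m + 1) ^ 4 := by
      have e1 : N + 2 = 8 * m ^ 3 + 8 * m ^ 2 + 2 * m + 2 := by rw [hN]; ring
      have e2 : 8 * (m + 1) ^ 4 = 8 * m ^ 4 + 32 * m ^ 3 + 48 * m ^ 2 + 32 * m + 8 := by ring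
      rw [e1, e2]
      nlinarith [Nat.zero_le (m ^ 4), Nat.zero_le (m ^ 3), Nat.zero_le (m ^ 2)]
    have hN2 : N + 2 < 2 ^ (4 * p + 7) := by
      have h4 : (m + 1) ^ 4 < (2 ^ (p + 1)) ^ 4 := Nat.pow_lt_pow_left hp1 (by norm_num)
      have e3 : 8 * (2 ^ (p + 1)) ^ 4 = 2 ^ (4 * p + 7) := by
        rw [← pow_mul, show (8 : ℕ) = 2 ^ 3 by norm_num, ← pow_add]
        congr 1
        ring
      calc N + 2 ≤ 8 * (m + 1) ^ 4 := hN1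
        _ < 8 * (2 ^ (p + 1)) ^ 4 := by omega
        _ = 2 ^ (4 * p + 7) := e3
    have hL : Nat.log 2 (N + 2) + 1 ≤ 4 * p + 7 := by
      have := Nat.log_lt_of_lt_pow (by omega : N + 2 ≠ 0) hN2
      omega
    have hq : (4 * p + 7) * (4 * p + 7) ≤ 169 * m := by
      have e4 : (4 * p + 7) * (4 * p + 7) = 16 * (p * p) + 56 * p + 49 := by ring
      rw [e4]
      have hone : 1 ≤ 2 ^ p := Nat.one_le_two_pow
      omega
    have hpow1 : (N + 2) ^ (A * (Nat.log 2 (N + 2) + 1)) ≤ 2 ^ (169 * A * m) := by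
      calc (N + 2) ^ (A * (Nat.log 2 (N + 2) + 1))
          ≤ (2 ^ (4 * p + 7)) ^ (A * (Nat.log 2 (N + 2) + 1)) := Nat.pow_le_pow_left hN2.le _
        _ ≤ (2 ^ (4 * p + 7)) ^ (A * (4 * p + 7)) :=
            Nat.pow_le_pow_right (by positivity) (Nat.mul_le_mul_left _ hL)
        _ = 2 ^ (A * ((4 * p + 7) * (4 * p + 7))) := by rw [← pow_mul]; congr 1; ring
        _ ≤ 2 ^ (169 * A * m) := Nat.pow_le_pow_right (by norm_num) (by
            calc A * ((4 * p + 7) * (4 * p + 7)) ≤ A * (169 * m) := Nat.mul_le_mul_left _ hq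
              _ = 169 * A * m := by ring)
    have hm1 : 2 * m + 1 ≤ 2 ^ (2 * m) := by
      have h1 : m < 2 ^ m := Nat.lt_two_pow_self
      have h2 : 2 ≤ 2 ^ m := by
        calc (2 : ℕ) = 2 ^ 1 := by norm_num
          _ ≤ 2 ^ m := Nat.pow_le_pow_right (by norm_num) hm
      calc 2 * m + 1 ≤ 2 * 2 ^ m := by omega
        _ ≤ 2 ^ m * 2 ^ m := Nat.mul_le_mul_right _ h2
        _ = 2 ^ (2 * m) := by rw [← pow_add]; congr 1; ring
    have hsA : (s + 2) ^ A ≤ (s + 2) ^ (169 * A + 13) := Nat.pow_le_pow_right (by omega) (by omega)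
    have hexp : 2 * m + 169 * A * m ≤ (169 * A + 13) * m := by nlinarith [Nat.zero_le (A * m)]
    calc (2 * m + 1) * vsliceBd A m s = (2 * m + 1) * ((s + 2) ^ A * (N + 2) ^ (A * (Nat.log 2 (N + 2) + 1))) := by
          rw [hN]; rfl
      _ ≤ 2 ^ (2 * m) * ((s + 2) ^ (169 * A + 13) * 2 ^ (169 * A * m)) :=
          Nat.mul_le_mul hm1 (Nat.mul_le_mul hsA hpow1)
      _ = 2 ^ (2 * m + 169 * A * m) * (s + 2) ^ (169 * A + 13) := by rw [pow_add]; ring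
      _ ≤ 2 ^ ((169 * A + 13) * m) * (s + 2) ^ (169 * A + 13) :=
          Nat.mul_le_mul_right _ (Nat.pow_le_pow_right (by norm_num) hexp)
  · have hexp : 13 * m ≤ (169 * A + 13) * m := by nlinarith [Nat.zero_le (A * m)]
    exact Nat.mul_le_mul (Nat.pow_le_pow_right (by norm_num) hexp) (Nat.pow_le_pow_right (by omega) (by omega))

omit [Fintype σ] [DecidableEq σ] in
/-- **R6c — THE THREE-TERM (ARITHMETIC-PROGRESSION) RANK-ONE LAW, UNCONDITIONAL.**  If ALL additive coincidences of the
letter family `A_j = supp u_j ∪ supp v_j` come from ONE three-term relation `α + γ = β + β` among DISTINCT letters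
(`RankOneCoincidences A (2·e_β) (e_α + e_γ)`: on letter multisets every coincidence is a multiple of `{β, β} ~ {α, γ}`),
then GLOBALLY `#visible ≤ 2^{c m} (#T + 2)^c` — the same shape as R3♯ `permTypeLaw_proof` (`k = 0`) and R6
`rankOneFourLaw_proof` (four-term shape).  Mechanism: the VERONESE LIFT `Y_α ↦ Z², Y_β ↦ ZW, Y_γ ↦ W²` realises the toric
ring of the relation inside a free ring; after DOUBLING all planar exponents the push-forward `Z ↦ α, W ↦ γ, Y_e ↦ 2e`
lands in `ℕ²`; rank-one coincidences = injectivity on the lifted support; Lemma A upstairs = the tree's `toric_minLog`;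
the coefficient theorem `coeff_veronese_logTrunc` (fibre = `#β ≡ x_a (mod 2)`, degree CONSTANT on fibres, multinomial
regrouping `C(h,(b+k)/2)·C((b+k)/2,k)` in the half-degree `h`) makes every slice `b = x_W ≤ 2m` a binomial-exponential
sum of width `≤ 2m(2m+1)²`, counted by val-lit-p3 g14's tool `BinExpSum.binExpPencilCount` (via `binExpPencilCount_fintype`);
degenerate case (a relation letter outside the alphabet) via R3♯.  Stated by its LITERAL body (no parameter-free
`def … : Prop`, cf. the R6 port delta), so a line file can wire its own `def` against it by `exact`.  Nothing here closes
the residual of the line `relation_ladder`, the crux `TwoProducts` (5906) or `VP ≠ VNP`. [folklore] -/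
theorem rankOneThreeAPLaw_proof :
  ∃ c : ℕ, ∀ (m : ℕ) (u v : Fin m → MvPolynomial (Fin 2) ℂ), (∀ j, coeff 0 (u j) = 0) → (∀ j, coeff 0 (v j) = 0) →
    (∃ α β γ : Expo, α ≠ β ∧ α ≠ γ ∧ β ≠ γ ∧ α + γ = β + β ∧
      RankOneCoincidences (fun j => (u j).support ∪ (v j).support)
        (Finsupp.single β 2) (Finsupp.single α 1 + Finsupp.single γ 1)) →
    ∀ S : Finset Expo, (∀ l ∈ S, ∃ ξ : Fin 2 → ℝ, ValidWeight u v ξ ∧ IsStrictTop ξ ↑(tailDiff u v).support l) →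
      S.card ≤ 2 ^ (c * m) * ((tailSupport u v).card + 2) ^ c := by
  classical
  obtain ⟨A, hA⟩ := binExpPencilCount_fintype
  obtain ⟨c, hc1, hc2⟩ := arith_R6c A
  refine ⟨c, fun m u v hu hv hrel S hS => ?_⟩
  obtain ⟨α, β, γ, hab, hac, hbc, hrel, hR⟩ := hrel
  rcases S.eq_empty_or_nonempty with hSe | hSne
  · simp [hSe]
  obtain ⟨l₀, hl₀⟩ := hSne
  obtain ⟨ξ₀, hval₀, htop₀⟩ := hS l₀ hl₀
  have hm : 1 ≤ m := by
    rcases Nat.eq_zero_or_pos m with h | h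
    · exfalso
      subst h
      apply mem_support_iff.mp htop₀.1
      unfold tailDiff
      simp
    · exact h
  by_cases hall : α ∈ tailSupport u v ∧ β ∈ tailSupport u v ∧ γ ∈ tailSupport u v
  · obtain ⟨hα, hβ, hγ⟩ := hall
    let D : APData u v := ⟨α, β, γ, hα, hβ, hγ, hab, hac, hbc, hrel⟩
    have h := (D.count hA hu hv hR S hS).trans (hc1 m (sE u v) hm)
    exact h
  · have hex : ∃ e : Expo, (e = α ∨ e = β ∨ e = γ) ∧ e ∉ tailSupport u v := by
      simp only [not_and_or] at hall
      rcases hall with h | h | h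
      exacts [⟨α, Or.inl rfl, h⟩, ⟨β, Or.inr (Or.inl rfl), h⟩, ⟨γ, Or.inr (Or.inr rfl), h⟩]
    obtain ⟨e, he, hnot⟩ := hex
    have hnotj : ∀ j, e ∉ (u j).support ∪ (v j).support := by
      intro j hj
      apply hnot
      rcases Finset.mem_union.mp hj with h | h
      · exact support_u_subset u v j h
      · exact support_v_subset u v j h
    have hperm : PermType (fun j => (u j).support ∪ (v j).support) :=
      permType_of_absent_letter3 _ α β γ hab hac hbc hR e he hnotj
    calc S.card ≤ 2 ^ (13 * m) * ((tailSupport u v).card + 2) ^ 2 := permTypeLaw_proof m u v hu hv hperm S hS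
      _ ≤ 2 ^ (c * m) * ((tailSupport u v).card + 2) ^ c := hc2 m _

omit [Fintype σ] [DecidableEq σ] in
/-- The same law with the relation read in the other orientation (`RankOneCoincidences A (e_α + e_γ) (2·e_β)`) and the
midpoint written as `2 • β` — a convenience corollary for by-name wiring. [folklore] -/
theorem rankOneThreeAPLaw_proof' :
  ∃ c : ℕ, ∀ (m : ℕ) (u v : Fin m → MvPolynomial (Fin 2) ℂ), (∀ j, coeff 0 (u j) = 0) → (∀ j, coeff 0 (v j) = 0) →
    (∃ α β γ : Expo, α ≠ β ∧ α ≠ γ ∧ β ≠ γ ∧ α + γ = 2 • β ∧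
      RankOneCoincidences (fun j => (u j).support ∪ (v j).support)
        (Finsupp.single α 1 + Finsupp.single γ 1) (Finsupp.single β 2)) →
    ∀ S : Finset Expo, (∀ l ∈ S, ∃ ξ : Fin 2 → ℝ, ValidWeight u v ξ ∧ IsStrictTop ξ ↑(tailDiff u v).support l) →
      S.card ≤ 2 ^ (c * m) * ((tailSupport u v).card + 2) ^ c := by
  obtain ⟨c, hc⟩ := rankOneThreeAPLaw_proof
  refine ⟨c, fun m u v hu hv hrel S hS => hc m u v hu hv ?_ S hS⟩
  obtain ⟨α, β, γ, hab, hac, hbc, hrel, hR⟩ := hrel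
  exact ⟨α, β, γ, hab, hac, hbc, by rw [hrel, two_nsmul], rankOneCoincidences_symm _ _ _ hR⟩

end VeroneseCount

end R6c
end Summit.ValiantsHypothesis.ValiantsHypothesis.Theorems.NewtonUnitEquations.TwoProducts.PermutationType

end
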